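import Summits.PneNP.PneNP.Theses.OneSlice
import Summits.PneNP.PneNP.Theorems.OneSliceConstantBandDefs
import Summits.PneNP.PneNP.Theorems.OneSliceConstantBandSliceLemma23
import Summits.PneNP.PneNP.Theorems.OneSliceConstantBandNearCliqueContiguity
import Summits.PneNP.PneNP.Theorems.OneSliceConstantBandRelMintermStep
import Summits.PneNP.PneNP.Theorems.OneSliceConstantBandTransferStep
import Summits.PneNP.PneNP.Theorems.OneSliceConstantBandAdvSparseGlue

/-!
# Line `flat-prior-relative-minterms` for crux `ConstantBand` (stmt-PneNP-2834, route PneNP/OneSlice) — skeleton v3 (c1; re-owned unchanged by seats c2–c6, and by seat c7 2026-08-17T05:40Z)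

Crux (by name): `Summit.PneNP.PneNP.Theses.OneSlice.ConstantBand` —
`∀ c, ∃ k ≥ 3, ∃ w, ∃ δ > 0, ∀ᶠ n, ∀ central j, ∀ {∧₂,∨₂}-circuit C, bandErr ≤ δ → n^c < |C|`.

STATUS (lead prover-line-stmt-PneNP-2834-0 cycles 1–3; continuation lead prover-line-stmt-PneNP-2834-c1-0 from 2026-08-16T12:28Z,
skeleton re-checked rc 0 / 1 sorry and re-registered unchanged): FOUR of the five registered stubs are LANDED
theorems of the tree (p95178 S1, p95183 S2, p95176 S3, p95171 S5; vocabulary p94870/p95140; glue p95392) and are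
imported here by name —
* `stub_sliceLemma23 : SliceLemma23` (`Theorems/OneSliceConstantBandSliceLemma23.lean`, helpers `…Aux`, `…Moment`),
* `stub_nearCliqueContiguity : NearCliqueContiguity` (`Theorems/OneSliceConstantBandNearCliqueContiguity.lean`,
  helpers `…Count/Pairs/Fibres/Moment/Window`),
* `stub_relMintermStep : NearCliqueContiguity → RelMintermPlanted` (`Theorems/OneSliceConstantBandRelMintermStep.lean`,
  helper `…Aux`),
* `stub_transferStep : SliceLemma23 → BandPair → ConstantBandSchedule` (`Theorems/OneSliceConstantBandTransferStep.lean`,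
  helper `…Aux`);
the vocabulary is `Theorems/OneSliceConstantBandDefs.lean`. The ONLY remaining `sorry` is the engine
`stub_relMintermSparse : RelMintermSparse` (S4, XL, OPEN): "size-`n^c` monotone circuits have relative clique-minterm
density `< 1/2` under the band law". Its designated proof route (one-law relativised closure census with a junk
filter) is refuted for EVERY census shape by the two obstruction notes of this crux
(`NegativeNote-forgeable-witnesses.md`: gate-local filters forged by `[x_{e₀}] ∧ [|x ∩ E(U)| ≥ a]`, supply
`n^{-3+1/(k-1)}` per gate, k-independent; `NegativeNote-latent-junk-census-cap.md`: a silent count disjunct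
`u ∧ (v ∨ J)` under every ∧-gate makes every descent terminal `n^{-3+1/(k-1)}`-promiscuous, so any per-pair gate
charge certifies at most `|C| ≳ n^{3−1/(k−1)}`), while the STATEMENT survives every cheap attack (drefute r1;
Disproof §3/§4 calibrations: its `k` must satisfy `k ≥ 2c − O(1)`). Equivalent clean form: `AdvSparse`
(planted-detection advantage `≤ ρ·#lower`; `AdvSparse → RelMintermSparse` and `AdvSparse → BandPair` in
`Theorems/OneSliceConstantBandAdvSparseGlue.lean`) — an FPT average-case planted-`k`-clique distinguisher lower
bound at the appearance threshold. The composition `ConstantBand_of` below takes that one stub and concludes the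
crux BY NAME; `bandPair_of` is a real proof.

Disproof.lean (standing disprover gen 1, v3.2, cycles 1–3; landed `Theorems/ConstantBand/Negative/{LoadBearing,
ExponentVsK, DeltaFloor}`) honoured: §0 schedule form (`constantBand_iff`, re-exported through the Defs module) /
"∃ w = all large w" — every obligation is "∃ w₀, ∀ w ≥ w₀" or "∀ w" and `bandPair_of` takes `w = max w₀ w₁ ⊔ C(k,2)`;
§1 basis — `C.IsOver monotoneBasis` is kept in `RelMintermSparse`/`BandPair` and monotonicity of `C.eval` is USED in
`bandPair_of`; §2 centrality — every probabilistic stub is stated for `Central k n j` only; §3 `le_of_bandLB`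
(c ≤ k+2) — `RelMintermSparse`/`BandPair` are `∀ c ∃ k`; §4 δ-floor — `stub_transferStep` produces
`δ = min(γ²/(4L), 1/6)`; §5 band pseudo-complements — the named residual of `RelMintermSparse` (count thresholds have
density `1/#lowerBand`) is exactly the scale-`≤ w` negation the band withholds. No `-- Targets` stub kill exists.
-/

set_option linter.dupNamespace false

namespace Summit.PneNP.PneNP.Cruxes.ConstantBand.FlatPriorRelativeMinterms

open Literature.Computability.Complexity Finset Filter Classical
open Summit.PneNP.PneNP.Theses.OneSlice (ConstantBand)

noncomputable section

/-! ## The one open registered stub (statement = `RelMintermSparse`, expanded; `sorry` lives here and nowhere else) -/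

/-- stub S4 (XL, HARDEST, open): sparsity of relative clique-minterms of small monotone circuits under the band law —
`RelMintermSparse` expanded. -/
theorem stub_relMintermSparse :
    ∀ c : ℕ, ∃ k : ℕ, 3 ≤ k ∧ ∃ ρ : ℝ, ρ < 1 / 2 ∧ ∃ w₁ : ℕ, ∀ w : ℕ, w₁ ≤ w → ∀ᶠ n : ℕ in atTop,
      ∀ j : ℕ, Central k n j → ∀ C : Circuit (Edge n), C.IsOver monotoneBasis → C.size ≤ n ^ c →
        ∑ i ∈ lowerBand k j w, pairProb n k i (IsRelMinterm C.eval) ≤ ρ * #(lowerBand k j w) := by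
  sorry

/-- `RelMintermSparse` is definitionally stub S4. -/
theorem relMintermSparse_holds : RelMintermSparse := stub_relMintermSparse

/-! ## Name-keyed alias (the skeleton audit admits a hypothesis of the composition only if its head constant is a
registered obligation or is NAMED like a declared stub) -/
namespace Registered

/-- Alias of `RelMintermSparse` keyed by the registered stub name. -/
abbrev stub_relMintermSparse : Prop := RelMintermSparse

end Registered

/-! ## Composition (real proofs) -/

/-- For `C(k,2) ≤ w` the centre `j` lies in the lower band, so the lower band is non-empty. -/
theorem mem_lowerBand_self {k j w : ℕ} (hw : k.choose 2 ≤ w) : j ∈ lowerBand k j w := by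
  simp only [lowerBand, mem_Icc]
  omega

/-- **BandPair from the brick and the engine.** Given `c`, the engine supplies `k`, `ρ < 1/2`, `w₁`; put
`γ := (1/2 − ρ)/4`, take `w₀` from `RelMintermPlanted` and `w := max (max w₀ w₁) C(k,2)`. A small monotone `C`
accepting all but `γ` of the planted pairs yet rejecting half the band would have relative-minterm density
`≥ 1/2 − 2γ = 1/4 + ρ/2 > ρ` on a non-empty lower band — contradiction. -/
theorem bandPair_of (hR : RelMintermPlanted) (hS : RelMintermSparse) : BandPair := by
  intro c
  obtain ⟨k, hk, ρ, hρ, w₁, hSw⟩ := hS c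
  set γ : ℝ := (1 / 2 - ρ) / 4 with hγ
  have hγ0 : 0 < γ := by rw [hγ]; linarith
  obtain ⟨w₀, hRw⟩ := hR k hk γ hγ0
  set w : ℕ := max (max w₀ w₁) (k.choose 2) with hwdef
  have hw₀ : w₀ ≤ w := le_trans (le_max_left _ _) (le_max_left _ _)
  have hw₁ : w₁ ≤ w := le_trans (le_max_right _ _) (le_max_left _ _)
  have hwk : k.choose 2 ≤ w := le_max_right _ _
  refine ⟨k, hk, w, γ, hγ0, ?_⟩
  filter_upwards [hRw w hw₀, hSw w hw₁] with n hRn hSn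
  intro j hj C hC hsize hplanted
  by_contra hband
  push Not at hband
  have hmono : Monotone C.eval := C.monotone_eval_of_isOver_monotoneBasis hC
  have h1 := hRn j hj C.eval hmono hplanted hband
  have h2 := hSn j hj C hC hsize
  have hL : (1 : ℝ) ≤ #(lowerBand k j w) := by
    have : 1 ≤ #(lowerBand k j w) := card_pos.2 ⟨j, mem_lowerBand_self hwk⟩
    exact_mod_cast this
  have h3 : (1 / 2 - 2 * γ) * (#(lowerBand k j w) : ℝ) ≤ ρ * #(lowerBand k j w) := h1.trans h2
  have h4 : (1 / 2 - 2 * γ : ℝ) = 1 / 4 + ρ / 2 := by rw [hγ]; ring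
  rw [h4] at h3
  nlinarith [mul_pos (by linarith : (0 : ℝ) < 1 / 4 - ρ / 2) (by linarith : (0 : ℝ) < #(lowerBand k j w))]

/-- **The composition**: the four LANDED stubs (`stub_sliceLemma23`, `stub_nearCliqueContiguity`,
`stub_relMintermStep`, `stub_transferStep`, tree theorems) and the one open engine imply the crux, concluded BY NAME. -/
theorem ConstantBand_of (h₄ : Registered.stub_relMintermSparse) : ConstantBand :=
  constantBand_iff.2
    (stub_transferStep stub_sliceLemma23 (bandPair_of (stub_relMintermStep stub_nearCliqueContiguity) h₄))

/-- Wiring check — the assembled skeleton: the registered stub feeds `ConstantBand_of` as stated (an `example`, so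
that `ConstantBand_of` stays the only named theorem of this file concluding the crux). -/
example : ConstantBand := ConstantBand_of stub_relMintermSparse

/-- Alternative wiring through the engine's ADVANTAGE form (landed glue `fprm_bandPair_of_advSparse`, p95392):
`AdvSparse` alone — with the landed S1 and S5, no contiguity and no flat prior — gives the crux; and
`fprm_relMintermSparse_of_advSparse : AdvSparse → RelMintermSparse` shows it also feeds `ConstantBand_of`. -/
example (hA : AdvSparse) : ConstantBand :=
  constantBand_iff.2 (stub_transferStep stub_sliceLemma23 (fprm_bandPair_of_advSparse hA))

end

end Summit.PneNP.PneNP.Cruxes.ConstantBand.FlatPriorRelativeMinterms
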